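import Literature.AnabelianGeometry.EtaleTheta.SettingModelCurve
import Literature.AnabelianGeometry.EtaleTheta.Discharge.Sec1OriginOfFree
import HarnessLib

/-!
# A model of the [EtTh] §1 root, part E: the inhabitant `model p : ThetaSetting p` and its guard

Mochizuki, *The étale theta function …*, Publ. RIMS **45** (2009) [EtTh], §1, PRIMS PDF pp. 11–15, 17
[cite: MochizukiEtTh2009, §1 p.12]. Layer L2 of the abc-iut cell, seat abc-iut-L2-t1 (root owner): the
LAST file of the explicit inhabitant of the L2 root interface `ThetaSetting p` (`Setting.lean`), built
over parts A–D (`SettingModelHeisenberg`, `…FreeGroup`, `…Galois`, `…Curve`):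

* `K := ℚ_p`, `q_X := p²` (`‖p²‖ < 1`, `p² ≠ 0`), `q̈ := p ∈ K` (so that condition (I) `K = K̈` of
  Def. 1.7 is within reach of an extension to `MuTwoSetting`);
* `Π^tp_X := F₂ × G_{ℚ_p}` (discrete) `↪ Π_X := F̂₂ × Ĝ_{ℚ_p}` (part D), `Δ_X = F̂₂ × 1`;
* `Π^tp_X ↠ Z`: the `a`-exponent sum on `F₂` (kernel `Δ_Y × G_{ℚ_p}`);
* `(Π^tp_X)^Θ := Π^tp_X / toHat⁻¹([[Δ_X,Δ_X],Δ_X]⁻)`, `(Π^tp_X)^ell := Π^tp_X / toHat⁻¹([Δ_X,Δ_X]⁻)` — so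
  the two printed kernel conditions hold BY CONSTRUCTION, and `Δ_Θ` is commutative and central in
  `(Δ^tp_X)^Θ` by continuity of commutators (part D);
* `Π^tp_{Y_N} := Δ_{Y_N} × G_{K_N}`, `Π^tp_{Z_N} := Δ_{Z_N} × G_{J_N}` with `Δ_{Y_N} ⊇ Δ_{Z_N}` the
  Heisenberg preimages of part A (indices `N`, `N`) and `K_N = ℚ_p(μ_N, p^{1/N})`, `J_N` the fields of
  `Setting.lean` (normal fixing subgroups, part C); `Ker(↠ (Π^tp_X)^Θ) ∩ Π^tp_{Y_N} ⊆ Π^tp_{Z_N}` by the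
  class-2 shadow of part B.

RESULT: `ThetaSetting.model p : ThetaSetting p`, `ThetaSetting.model_isEtThOrigin :
(model p).IsEtThOrigin` (via abc-iut-L2-t1 gen 2's `IsEtThOrigin.of_free` and part D's
`isFreeProfiniteOnTwo_deltaHat`), hence `∃ D : ThetaSetting p, D.IsEtThOrigin`: the root interface AND
its vacuity guard are jointly satisfiable, so every cell statement of the shape
`∀ D : ThetaSetting p, D.IsEtThOrigin → …` quantifies over a kernel-inhabited domain. HONEST LIMITS:
consistency evidence only — the model is degenerate along the tempered topology (everything discrete;
`Δ_Θ` is the centre of the DISCRETE Heisenberg group, infinite cyclic and merely dense in the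
`Ẑ`-factor), it is not the tempered fundamental group of a curve, and nothing of [EtTh] is asserted;
no side is taken on [IUTchIII] Cor. 3.12. No instances on existing types; no Prop facts.
-/

noncomputable section

namespace Literature.AnabelianGeometry.EtaleTheta.SettingModel

open Literature.AnabelianGeometry.SemiGraphs
open CategoryTheory
open scoped commutatorElement

variable (p : ℕ) [Fact p.Prime]

/-! ### The theta quotients `(Π^tp_X)^Θ`, `(Π^tp_X)^ell` -/

/-- `(Π^tp_X)^Θ := Π^tp_X / toHat⁻¹([[Δ_X,Δ_X],Δ_X]⁻)` ([EtTh] p. 12). [cite: MochizukiEtTh2009, §1 p.12] -/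
abbrev GTheta : Type := PiTp p ⧸ KTheta p

/-- `(Π^tp_X)^ell := Π^tp_X / toHat⁻¹([Δ_X,Δ_X]⁻)` ([EtTh] p. 12). [cite: MochizukiEtTh2009, §1 p.12] -/
abbrev GEll : Type := PiTp p ⧸ KEll p

/-- `Π^tp_X ↠ (Π^tp_X)^Θ`. [cite: MochizukiEtTh2009, §1 p.12] -/
def toThetaM : PiTp p →* GTheta p := QuotientGroup.mk' (KTheta p)

/-- `(Π^tp_X)^Θ ↠ (Π^tp_X)^ell`. [cite: MochizukiEtTh2009, §1 p.12] -/
def thetaToEllM : GTheta p →* GEll p :=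
  QuotientGroup.map (KTheta p) (KEll p) (MonoidHom.id _)
    (fun x hx => by simpa using KTheta_le_KEll p hx)

/-- [cite: MochizukiEtTh2009, §1 p.12] -/
theorem thetaToEllM_comp : (thetaToEllM p).comp (toThetaM p) = QuotientGroup.mk' (KEll p) := by
  ext x
  rfl

/-- `Ker(Π^tp_X ↠ (Π^tp_X)^ell) = toHat⁻¹([Δ_X,Δ_X]⁻)` — the printed kernel condition, by construction.
[cite: MochizukiEtTh2009, §1 p.12] -/
theorem ker_toEllM : ((thetaToEllM p).comp (toThetaM p)).ker = KEll p := by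
  rw [thetaToEllM_comp]
  exact QuotientGroup.ker_mk' _

/-- [cite: MochizukiEtTh2009, §1 p.12] -/
theorem mk_mem_ker_thetaToEllM_iff (x : PiTp p) :
    (x : GTheta p) ∈ (thetaToEllM p).ker ↔ x ∈ KEll p := by
  rw [MonoidHom.mem_ker]
  show thetaToEllM p (toThetaM p x) = 1 ↔ _
  rw [← MonoidHom.comp_apply, thetaToEllM_comp, QuotientGroup.mk'_apply, QuotientGroup.eq_one_iff]

/-- The group-theoretic identity `a·b·(b·a)⁻¹ = ⁅a, b⁆`. [folklore] -/
private theorem mul_div_mul_comm_eq {G : Type*} [Group G] (a b : G) : a * b / (b * a) = ⁅a, b⁆ := by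
  rw [commutatorElement_def, div_eq_mul_inv, mul_inv_rev, ← mul_assoc]

/-- **`Δ_Θ = Ker((Π^tp_X)^Θ ↠ (Π^tp_X)^ell)` is commutative** in the model (continuity of commutators:
`[closure[Δ,Δ], Δ] ⊆ closure[[Δ,Δ],Δ]`). [cite: MochizukiEtTh2009, §1 p.12] -/
theorem ker_thetaToEllM_comm :
    ∀ x ∈ (thetaToEllM p).ker, ∀ y ∈ (thetaToEllM p).ker, x * y = y * x := by
  intro x hx y hy
  obtain ⟨a, rfl⟩ := QuotientGroup.mk_surjective x
  obtain ⟨b, rfl⟩ := QuotientGroup.mk_surjective y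
  have ha : a ∈ KEll p := (mk_mem_ker_thetaToEllM_iff p a).mp hx
  have hb : b ∈ KEll p := (mk_mem_ker_thetaToEllM_iff p b).mp hy
  rw [← QuotientGroup.mk_mul, ← QuotientGroup.mk_mul, QuotientGroup.eq_iff_div_mem,
    mul_div_mul_comm_eq]
  exact commutatorElement_mem_KTheta p ha (toHat_mem_deltaHat_of_mem_KEll p hb)

/-- **`Δ_Θ` is central in `(Δ^tp_X)^Θ`** in the model. [cite: MochizukiEtTh2009, §1 p.12] -/
theorem ker_thetaToEllM_central :
    ∀ x ∈ (thetaToEllM p).ker, ∀ y ∈ ((curve p).aug.toMonoidHom.ker).map (toThetaM p),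
      x * y = y * x := by
  intro x hx y hy
  obtain ⟨a, rfl⟩ := QuotientGroup.mk_surjective x
  obtain ⟨c, hc, rfl⟩ := hy
  have ha : a ∈ KEll p := (mk_mem_ker_thetaToEllM_iff p a).mp hx
  show (a : GTheta p) * (c : GTheta p) = (c : GTheta p) * (a : GTheta p)
  rw [← QuotientGroup.mk_mul, ← QuotientGroup.mk_mul, QuotientGroup.eq_iff_div_mem,
    mul_div_mul_comm_eq]
  exact commutatorElement_mem_KTheta p ha (toHat_mem_deltaHat_of_mem_deltaTemp p hc)

/-! ### `Π^tp_X ↠ Z` -/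

/-- `Π^tp_X ↠ Z`: the `a`-exponent sum (`x`-coordinate of the Heisenberg image) of the `F₂`-component
("a natural surjection `Π^tp_X ↠ Z`", p. 12). [cite: MochizukiEtTh2009, §1 p.12] -/
def toZM : PiTp p →* Multiplicative ℤ :=
  ((Heis.xHom.comp heisHom).comp Del.val).comp (MonoidHom.fst Del (Gam p))

/-- [cite: MochizukiEtTh2009, §1 p.12] -/
theorem toZM_apply (g : PiTp p) : toZM p g = Multiplicative.ofAdd (heisHom (Del.val g.1)).x := rfl

/-- `Ker(Π^tp_X ↠ Z) = Δ_Y × Γ` (`Π^tp_Y`, p. 12). [cite: MochizukiEtTh2009, §1 p.12] -/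
theorem ker_toZM : (toZM p).ker = (deltaY.comap Del.val).prod ⊤ := by
  ext g
  simp only [MonoidHom.mem_ker, Subgroup.mem_prod, Subgroup.mem_comap, Subgroup.mem_top, and_true,
    deltaY]
  rfl

/-- `Π^tp_X ↠ Z` is surjective. [cite: MochizukiEtTh2009, §1 p.12] -/
theorem toZM_surjective : Function.Surjective (toZM p) := by
  intro n
  obtain ⟨h, hh⟩ := heisHom_surjective ⟨Multiplicative.toAdd n, 0, 0⟩
  obtain ⟨d, rfl⟩ := Del.val_bijective.2 h
  exact ⟨(d, 1), by simp [toZM_apply, hh]⟩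

/-- Already `Δ^tp_X ↠ Z` is surjective ("`Δ^tp_X/Δ^tp_Y ≅ Z`", pp. 16, 28). [cite: MochizukiEtTh2009, §1 p.16] -/
theorem toZM_delta_surjective :
    Function.Surjective ((toZM p).restrict (curve p).aug.toMonoidHom.ker) := by
  intro n
  obtain ⟨h, hh⟩ := heisHom_surjective ⟨Multiplicative.toAdd n, 0, 0⟩
  obtain ⟨d, rfl⟩ := Del.val_bijective.2 h
  refine ⟨⟨(d, 1), (mem_deltaTemp_iff p _).mpr rfl⟩, ?_⟩
  show toZM p (d, 1) = n
  simp [toZM_apply, hh]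

/-! ### The coverings `Y_N`, `Z_N` -/

/-- The model's `q`-parameter `q_X := p²` (so that `q̈ = p ∈ ℚ_p`). [cite: MochizukiEtTh2009, §1 p.13] -/
def qModel : PadicAlgCl p := ((p : ℕ) : PadicAlgCl p) ^ 2

/-- `p² ∈ ℚ_p ⊆ ℚ̄_p`. [folklore] -/
private theorem qModel_mem_bot : qModel p ∈ (⊥ : IntermediateField ℚ_[p] (PadicAlgCl p)) :=
  pow_mem (natCast_mem _ p) 2

/-- `p ≠ 0` in `ℚ̄_p`. [folklore] -/
private theorem natCast_ne_zero : ((p : ℕ) : PadicAlgCl p) ≠ 0 :=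
  Nat.cast_ne_zero.mpr (Fact.out : p.Prime).ne_zero

/-- `p² ≠ 0` in `ℚ̄_p`. [folklore] -/
private theorem qModel_ne_zero : qModel p ≠ 0 := pow_ne_zero 2 (natCast_ne_zero p)

/-- `G_{K_N} ≤ Γ` for `K_N = ℚ_p(μ_N, q_X^{1/N})`. [cite: MochizukiEtTh2009, §1 p.13] -/
def gKN (N : ℕ+) : Subgroup (Gam p) :=
  ((fieldKN ⊥ (qModel p) N).fixingSubgroup).comap (Gam.toGQp p).toMonoidHom

/-- `G_{J_N} ≤ Γ`. [cite: MochizukiEtTh2009, §1 p.14] -/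
def gJN (N : ℕ+) : Subgroup (Gam p) :=
  ((fieldJN ⊥ (qModel p) N).fixingSubgroup).comap (Gam.toGQp p).toMonoidHom

/-- `Π^tp_{Y_N} := Δ_{Y_N} × G_{K_N}` ("`1 → (Δ^tp_Y)^ell ⊗ ℤ/Nℤ → Gal(Y_N/Y) → Gal(K_N/K) → 1`", p. 13).
[cite: MochizukiEtTh2009, §1 p.13] -/
def YN (N : ℕ+) : Subgroup (PiTp p) := ((deltaYN N).comap Del.val).prod (gKN p N)

/-- `Π^tp_{Z_N} := Δ_{Z_N} × G_{J_N}` ("`1 → Δ_Θ ⊗ ℤ/Nℤ → Gal(Z_N/Y_N) → Gal(J_N/K_N) → 1`", p. 14).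
[cite: MochizukiEtTh2009, §1 p.14] -/
def ZN (N : ℕ+) : Subgroup (PiTp p) := ((deltaZN N).comap Del.val).prod (gJN p N)

/-- The augmentation carries `A × B` onto `B`. [folklore] -/
private theorem map_aug_prod (A : Subgroup Del) (B : Subgroup (GQp p)) :
    (A.prod (B.comap (Gam.toGQp p).toMonoidHom)).map (curve p).aug.toMonoidHom = B := by
  ext σ
  constructor
  · rintro ⟨x, ⟨-, hx⟩, rfl⟩
    exact hx
  · intro hσ
    exact ⟨((1 : Del), (σ : Gam p)), ⟨A.one_mem, hσ⟩, rfl⟩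

/-- `Δ^tp_X ∩ (A × B) = A × 1`. [folklore] -/
private theorem prod_inf_deltaTemp (A : Subgroup Del) (B : Subgroup (Gam p)) :
    A.prod B ⊓ (curve p).aug.toMonoidHom.ker = A.prod ⊥ := by
  ext g
  rw [Subgroup.mem_inf, Subgroup.mem_prod, Subgroup.mem_prod, Subgroup.mem_bot]
  constructor
  · rintro ⟨⟨h1, -⟩, h3⟩
    exact ⟨h1, (mem_deltaTemp_iff p g).mp h3⟩
  · rintro ⟨h1, h2⟩
    exact ⟨⟨h1, by rw [h2]; exact B.one_mem⟩, (mem_deltaTemp_iff p g).mpr h2⟩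

/-- `[A × 1 : A' × 1] = [A : A']`, and the latter is computed in `F₂`. [folklore] -/
private theorem relIndex_prod_bot (A' A : Subgroup F₂) :
    ((A'.comap Del.val).prod (⊥ : Subgroup (Gam p))).relIndex ((A.comap Del.val).prod ⊥) =
      A'.relIndex A := by
  have h1 : ∀ B : Subgroup Del, B.prod (⊥ : Subgroup (Gam p)) = B.map (MonoidHom.inl Del (Gam p)) := by
    intro B
    ext x
    constructor
    · rintro ⟨hx1, hx2⟩
      exact ⟨x.1, hx1, Prod.ext rfl ((Subgroup.mem_bot.mp hx2).symm)⟩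
    · rintro ⟨b, hb, rfl⟩
      exact ⟨hb, Subgroup.mem_bot.mpr rfl⟩
  have hinj : Function.Injective (MonoidHom.inl Del (Gam p)) := fun a b h => congrArg Prod.fst h
  have h2 := Subgroup.relIndex_comap ((A'.comap Del.val).map (MonoidHom.inl Del (Gam p)))
    (MonoidHom.inl Del (Gam p)) (A.comap Del.val)
  rw [Subgroup.comap_map_eq_self_of_injective hinj] at h2
  rw [h1, h1, ← h2, Subgroup.relIndex_comap, Subgroup.map_comap_eq_self_of_surjective
    Del.val_bijective.2]

/-- `Π^tp_{Y_1} = Π^tp_Y` (`Y_1 = Y`, p. 14). [cite: MochizukiEtTh2009, §1 p.14] -/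
theorem YN_one : YN p 1 = (toZM p).ker := by
  rw [ker_toZM, YN, PNat.one_coe, deltaYN_one, gKN, fieldKN_bot_one _ (qModel_mem_bot p),
    IntermediateField.fixingSubgroup_bot, Subgroup.comap_top]

/-- `Π^tp_{Y_N} ≤ Π^tp_Y`. [cite: MochizukiEtTh2009, §1 p.13] -/
theorem YN_le (N : ℕ+) : YN p N ≤ (toZM p).ker := by
  rw [ker_toZM]
  exact Subgroup.prod_mono (Subgroup.comap_mono (deltaYN_le_deltaY N)) le_top

/-- The image of `Π^tp_{Y_N}` in `G_{ℚ_p}` is `G_{K_N}`. [cite: MochizukiEtTh2009, §1 p.13] -/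
theorem map_aug_YN (N : ℕ+) :
    (YN p N).map (curve p).aug.toMonoidHom = (fieldKN ⊥ (qModel p) N).fixingSubgroup :=
  map_aug_prod p _ _

/-- `Π^tp_{Y_N}` is normal in `Π^tp_X`. [cite: MochizukiEtTh2009, §1 p.14] -/
theorem YN_normal (N : ℕ+) : (YN p N).Normal := by
  haveI := deltaYN_normal N
  haveI := fixingSubgroup_fieldKN_bot_normal _ (qModel_mem_bot p) N
  haveI : ((deltaYN N).comap Del.val).Normal := Subgroup.Normal.comap inferInstance _
  haveI : (gKN p N).Normal := Subgroup.Normal.comap inferInstance _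
  exact Subgroup.prod_normal _ _

/-- `Π^tp_{Y_N} ≤ Π^tp_{Y_M}` for `M ∣ N`. [cite: MochizukiEtTh2009, §1 p.18] -/
theorem YN_anti (M N : ℕ+) (h : (M : ℕ) ∣ N) : YN p N ≤ YN p M :=
  Subgroup.prod_mono (Subgroup.comap_mono (deltaYN_anti h))
    (Subgroup.comap_mono (IntermediateField.fixingSubgroup_antitone
      (fieldKN_bot_mono _ (qModel_ne_zero p) h)))

/-- **`[Δ^tp_Y : Δ^tp_{Y_N}] = N`** in the model. [cite: MochizukiEtTh2009, §1 p.16] -/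
theorem relIndex_YN (N : ℕ+) :
    (YN p N ⊓ (curve p).aug.toMonoidHom.ker).relIndex ((toZM p).ker ⊓ (curve p).aug.toMonoidHom.ker) =
      N := by
  rw [ker_toZM, YN, prod_inf_deltaTemp, prod_inf_deltaTemp, ← deltaYN_one, relIndex_prod_bot,
    relIndex_deltaYN]

/-- `Π^tp_{Z_N} ≤ Π^tp_{Y_N}`. [cite: MochizukiEtTh2009, §1 p.14] -/
theorem ZN_le (N : ℕ+) : ZN p N ≤ YN p N :=
  Subgroup.prod_mono (Subgroup.comap_mono (deltaZN_le_deltaYN N))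
    (Subgroup.comap_mono (IntermediateField.fixingSubgroup_antitone (fieldKN_le_fieldJN _ ⊥ N)))

/-- The image of `Π^tp_{Z_N}` in `G_{ℚ_p}` is `G_{J_N}`. [cite: MochizukiEtTh2009, §1 p.14] -/
theorem map_aug_ZN (N : ℕ+) :
    (ZN p N).map (curve p).aug.toMonoidHom = (fieldJN ⊥ (qModel p) N).fixingSubgroup :=
  map_aug_prod p _ _

/-- `Π^tp_{Z_N}` is normal in `Π^tp_X` (Prop. 1.1 (ii): "`Π^tp_X/Π^tp_{Z_N} = Gal(Z_N/X)`", p. 15).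
[cite: MochizukiEtTh2009, §1 p.15] -/
theorem ZN_normal (N : ℕ+) : (ZN p N).Normal := by
  haveI := deltaZN_normal N
  haveI := fixingSubgroup_fieldJN_bot_normal _ (qModel_mem_bot p) N
  haveI : ((deltaZN N).comap Del.val).Normal := Subgroup.Normal.comap inferInstance _
  haveI : (gJN p N).Normal := Subgroup.Normal.comap inferInstance _
  exact Subgroup.prod_normal _ _

/-- `Π^tp_{Z_N} ≤ Π^tp_{Z_M}` for `M ∣ N`. [cite: MochizukiEtTh2009, §1 p.18] -/
theorem ZN_anti (M N : ℕ+) (h : (M : ℕ) ∣ N) : ZN p N ≤ ZN p M :=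
  Subgroup.prod_mono (Subgroup.comap_mono (deltaZN_anti h))
    (Subgroup.comap_mono (IntermediateField.fixingSubgroup_antitone
      (fieldJN_bot_mono _ (qModel_ne_zero p) h)))

/-- **`[Δ^tp_{Y_N} : Δ^tp_{Z_N}] = N`** in the model. [cite: MochizukiEtTh2009, §1 p.14] -/
theorem relIndex_ZN (N : ℕ+) :
    (ZN p N ⊓ (curve p).aug.toMonoidHom.ker).relIndex (YN p N ⊓ (curve p).aug.toMonoidHom.ker) = N := by
  rw [ZN, YN, prod_inf_deltaTemp, prod_inf_deltaTemp, relIndex_prod_bot, relIndex_deltaZN]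

/-- **`Ker(Π^tp_X ↠ (Π^tp_X)^Θ) ∩ Π^tp_{Y_N} ⊆ Π^tp_{Z_N}`** in the model ("`Z_N` is cut out inside the
theta quotient", p. 14): by the class-2 shadow, such an element is `(g, 1)` with `g` dying in `Heis ℤ`.
[cite: MochizukiEtTh2009, §1 p.14] -/
theorem ker_toThetaM_inf_YN_le_ZN (N : ℕ+) : (toThetaM p).ker ⊓ YN p N ≤ ZN p N := by
  rintro g ⟨hg, -⟩
  rw [toThetaM, QuotientGroup.ker_mk'] at hg
  obtain ⟨h1, h2⟩ := heisHom_eq_one_and_snd_eq_one_of_mem_KTheta p hg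
  refine ⟨ker_heisHom_le_deltaZN N h1, ?_⟩
  show g.2 ∈ gJN p N
  rw [h2]
  exact (gJN p N).one_mem

/-! ### The inhabitant of `ThetaSetting p` -/

/-- **The model of the [EtTh] §1 root.** An explicit inhabitant of `ThetaSetting p` (`Setting.lean`):
`K := ℚ_p`, `q_X := p²`, `q̈ := p`, `Π^tp_X := F₂ × G_{ℚ_p}` discrete with profinite completion `F̂₂ × Ĝ_{ℚ_p}`, theta
quotients by the pulled-back closures of `[[Δ_X,Δ_X],Δ_X]`, `[Δ_X,Δ_X]`, `Z`-quotient the `a`-exponent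
sum, coverings `Y_N`, `Z_N` from the Heisenberg lattice and the fields `K_N`, `J_N`. Consistency
evidence only (degenerate along the tempered topology; not the `π₁` of a curve). [cite: MochizukiEtTh2009, §1 p.11] -/
abbrev _root_.Literature.AnabelianGeometry.EtaleTheta.ThetaSetting.model : ThetaSetting p where
  toTemperedCurve := curve p
  qX := qModel p
  qX_mem := qModel_mem_bot p
  norm_qX_lt_one := by
    rw [qModel, norm_pow, show ((p : ℕ) : PadicAlgCl p) = ((p : ℚ_[p]) : PadicAlgCl p) by simp,
      PadicAlgCl.norm_extends]
    exact pow_lt_one₀ (norm_nonneg _) Padic.norm_p_lt_one two_ne_zero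
  qX_ne_zero := qModel_ne_zero p
  sqrtqX := ((p : ℕ) : PadicAlgCl p)
  sqrtqX_sq := rfl
  toZ := toZM p
  toZ_surjective := toZM_surjective p
  isOpen_ker_toZ := isOpen_discrete _
  toZ_delta_surjective := toZM_delta_surjective p
  GtpTheta := GTheta p
  toTheta := toThetaM p
  continuous_toTheta := continuous_of_discreteTopology
  toTheta_surjective := QuotientGroup.mk'_surjective _
  ker_toTheta := QuotientGroup.ker_mk' _
  GtpEll := GEll p
  thetaToEll := thetaToEllM p
  continuous_thetaToEll := by
    haveI : DiscreteTopology (GTheta p) := QuotientGroup.discreteTopology (isOpen_discrete _)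
    exact continuous_of_discreteTopology
  thetaToEll_surjective := by
    intro y
    obtain ⟨b, rfl⟩ := QuotientGroup.mk_surjective y
    exact ⟨(b : GTheta p), rfl⟩
  ker_toEll := ker_toEllM p
  ker_thetaToEll_comm := ker_thetaToEllM_comm p
  ker_thetaToEll_central := ker_thetaToEllM_central p
  GtpYN := YN p
  GtpYN_one := YN_one p
  GtpYN_le := YN_le p
  map_aug_GtpYN := map_aug_YN p
  GtpYN_normal := YN_normal p
  isOpen_GtpYN _ := isOpen_discrete _
  GtpYN_anti := YN_anti p
  relIndex_deltaYN := relIndex_YN p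
  GtpZN := ZN p
  GtpZN_le := ZN_le p
  map_aug_GtpZN := map_aug_ZN p
  GtpZN_normal := ZN_normal p
  isOpen_GtpZN _ := isOpen_discrete _
  GtpZN_anti := ZN_anti p
  relIndex_deltaZN := relIndex_ZN p
  ker_toTheta_le_GtpZN := ker_toThetaM_inf_YN_le_ZN p

/-- **The model satisfies the vacuity guard `IsEtThOrigin`** ("`Δ_X` is a profinite free group on 2
generators", p. 12; second field via abc-iut-L2-t1 gen 2's `IsEtThOrigin.of_free`).
[cite: MochizukiEtTh2009, §1 p.12] -/
theorem _root_.Literature.AnabelianGeometry.EtaleTheta.ThetaSetting.model_isEtThOrigin :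
    (ThetaSetting.model p).IsEtThOrigin :=
  ThetaSetting.IsEtThOrigin.of_free (isFreeProfiniteOnTwo_deltaHat p)

/-- **Joint satisfiability of the L2 root and its guard**: `∃ D : ThetaSetting p, D.IsEtThOrigin` — every
cell statement `∀ D : ThetaSetting p, D.IsEtThOrigin → …` is non-vacuously quantified.
[cite: MochizukiEtTh2009, §1 p.12] -/
theorem _root_.Literature.AnabelianGeometry.EtaleTheta.ThetaSetting.exists_isEtThOrigin :
    ∃ D : ThetaSetting p, D.IsEtThOrigin :=
  ⟨ThetaSetting.model p, ThetaSetting.model_isEtThOrigin p⟩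

end Literature.AnabelianGeometry.EtaleTheta.SettingModel

end
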